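import Literature.MathematicalPhysics.QuantumFieldTheory.Balaban1983to89.BlockAveragingFederbush
import Literature.Analysis.Complex.RungeUnits
import HarnessLib

/-!
# Route `UnitScaleTilt`, crux K1 child «MinimiserStabilityRegPr» (stmt-QuantumFields-19200), registered stub `stub_prop7From14` (skeleton birth_v7
# cc37a178…; leaf V3 «Prop 7 from a background (14)») — THE GEODESIC INTERPOLATION STEP ON `U(N)` ∕ `SU(N)`:
# `t ↦ exp(t·log(ba*))·a`, the one-parameter arc from `a` to `b`, with membership, endpoints, equivariance and Lipschitz bounds

Cell `ym3-torus` ∕ fleet seat `ym-ust-19200-p1` (gen 9; HUMAN RULING D-0037, YM ladder rung R3).  WHY.  The (4)-internal `ℓ²` route to clause 1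
of [Balaban1985Variational] Prop. 7 at the T³ carrier (CARD-19200-V3-g3 … -g7) needs a (4)-representative of a pair `W, U₀` of one regular (0.4)-fibre
whose bond variables `W_bU₀,b⁻¹` are `O((ε₀ + e₀)·L^{−(K−n)})`-close to `1` on EVERY bond, uniformly in `k = K − n`.  The complete comb axial gauge of
gen 7 (`Prop7AxialGauge`, [Balaban1985RegularSpaces] Lemma 1) achieves this inside the blocks but only `O(ε₀ + e₀)` on the block faces
(`Prop7AxialLemma1`), and the `ℓ²`-optimal representative carries point charges at the centres (CARD-g7 §3).  The successor line (CARD-19200-V3-g9: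
«blended comb gauge») BLENDS the `2ᵈ` comb gauges of the centres surrounding a site by GEODESIC MULTILINEAR INTERPOLATION in `SU(2)` — a partition of
unity on the group, equivariant under the simultaneous left/right translations that relate the comb elements at the two ends of a bond.  This file
is the one-dimensional building block of that interpolation: the arc `G_t(a, b) = exp(t·log(b a*))·a` ([Balaban1985Averaging] (21), (23): the
logarithm `log X = Σ (−1)^{n+1}(X − 1)ⁿ/n` on `|X − 1| < 1`, `log U = iA` skew-Hermitian for unitary `U`), kernel-checked with explicit constants.

WHAT IS PROVED (sorry-free, no definition; `mlog` = `MatrixLog.mlog`, the `L²`-operator norm throughout).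
§0 `norm_conj_sub_one`; §1 `exp_smul_mlog_mem_unitaryGroup` ∕ `exp_smul_mlog_mem_specialUnitaryGroup`: for unitary (special unitary) `Q` with `‖Q − 1‖ ≤ 1/3`
   (and `N‖Q − 1‖ < π`) and real `t`, `exp(t·log Q) ∈ U(N)` (`SU(N)`).
§2 The arc: `arc_zero` (`G₀ = a`), `arc_one` (`G₁ = b`), `arc_mem_unitaryGroup` ∕ `arc_mem_specialUnitaryGroup`, **`arc_conj`** (equivariance
   `G_t(uaw, ubw) = u·G_t(a,b)·w` for unitary `u`, `w`), `arc_mul_star_arc` (`G_t·G_s* = exp((t − s)·log(ba*))`), **`norm_arc_mul_star_arc_sub_one_le`**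
   (`‖G_tG_s* − 1‖ ≤ 3|t − s|·‖ba* − 1‖` for `|t − s| ≤ 1`), `norm_arc_mul_star_sub_one_le` (`‖G_t a* − 1‖ ≤ 3|t|‖ba* − 1‖`: the arc stays near `a`).
§3 **`norm_arc_perturb_le`**: Lipschitz dependence on the endpoints under LEFT unitary perturbations `a ↦ pa`, `b ↦ qb`:
   `‖G_t(pa, qb)·G_t(a, b)* − 1‖ ≤ 8(‖p − 1‖ + ‖q − 1‖)` for `t ∈ [0, 1]`, `‖ba* − 1‖ ≤ 1/6`, `‖p − 1‖, ‖q − 1‖ ≤ 1/16`.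

HONEST SCOPE.  Elementary matrix analysis (no statement of [Balaban1985Variational] is proved here); count-neutral helper toward
stmt-QuantumFields-19200 (`--supports`), brick 1 of the blended-comb-gauge line (CARD-19200-V3-g9.md).

References: T. Bałaban, CMP 98 (1985) 17–51 [Balaban1985Averaging] ((19)–(27) pp.21–22); CMP 99 (1985) 75–102 [Balaban1985RegularSpaces] (Lemma 1 p.79);
CMP 102 (1985) 277–309 [Balaban1985Variational] ((4) p.278, (18) p.280).
-/

noncomputable section

open NormedSpace
open scoped Matrix.Norms.L2Operator

namespace Summit.QuantumFields.YangMills.Theorems.Prop7GeodesicInterp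

open Literature.MathematicalPhysics.QuantumFieldTheory.Balaban1983to89
open MatrixLog (mlog exp_mlog norm_mlog_le_two_mul)
open ExpMeanLog (star_mlog_eq_neg trace_mlog_eq_zero mlog_conj)
open FederbushMean (norm_mlog_sub_mlog_le)
open Literature.Analysis.Matrix (det_exp_eq_exp_trace)

variable {n : Type*} [Fintype n] [DecidableEq n]

/-! ## §0 Unitary bookkeeping in the `L²`-operator norm -/

/-- `‖uAu* − 1‖ = ‖A − 1‖` for unitary `u`. [cite: Balaban1985Averaging, (19) p.21] -/
theorem norm_conj_sub_one {u : Matrix n n ℂ} (hu : u ∈ Matrix.unitaryGroup n ℂ) (A : Matrix n n ℂ) :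
    ‖u * A * star u - 1‖ = ‖A - 1‖ := by
  have h : u * A * star u - 1 = u * (A - 1) * star u := by
    rw [mul_sub, sub_mul, mul_one, Unitary.mul_star_self_of_mem hu]
  rw [h, CStarRing.norm_mul_mem_unitary _ (Unitary.star_mem hu), CStarRing.norm_mem_unitary_mul _ hu]

/-! ## §1 The exponent `t·log Q` of a small unitary is skew-Hermitian: `exp(t·log Q) ∈ U(N)`, `SU(N)` -/

/-- For unitary `Q` with `‖Q − 1‖ ≤ 1/3` and real `t`: `(t·log Q)* = −t·log Q`. [cite: Balaban1985Averaging, (23) p.21] -/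
theorem star_smul_mlog {Q : Matrix n n ℂ} (hQ : Q ∈ Matrix.unitaryGroup n ℂ) (hs : ‖Q - 1‖ ≤ 1 / 3) (t : ℝ) :
    star (((t : ℂ)) • mlog Q) = -(((t : ℂ)) • mlog Q) := by
  have ht : star ((t : ℂ)) = (t : ℂ) := Complex.conj_ofReal t
  rw [star_smul, ht, star_mlog_eq_neg hQ hs, smul_neg]

/-- **`exp(t·log Q) ∈ U(N)`** for unitary `Q` with `‖Q − 1‖ ≤ 1/3`, `t ∈ ℝ`. [cite: Balaban1985Averaging, (23) p.21] -/
theorem exp_smul_mlog_mem_unitaryGroup {Q : Matrix n n ℂ} (hQ : Q ∈ Matrix.unitaryGroup n ℂ) (hs : ‖Q - 1‖ ≤ 1 / 3) (t : ℝ) :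
    exp (((t : ℂ)) • mlog Q) ∈ Matrix.unitaryGroup n ℂ := by
  letI : NormedAlgebra ℚ (Matrix n n ℂ) := NormedAlgebra.restrictScalars ℚ ℂ _
  set M : Matrix n n ℂ := ((t : ℂ)) • mlog Q with hM
  have hsk : star M = -M := star_smul_mlog hQ hs t
  rw [Matrix.mem_unitaryGroup_iff, star_exp, hsk, ← exp_add_of_commute (Commute.refl M).neg_right, add_neg_cancel, exp_zero]

/-- **`exp(t·log Q) ∈ SU(N)`** for `Q ∈ SU(N)` with `‖Q − 1‖ ≤ 1/3`, `N‖Q − 1‖ < π`, `t ∈ ℝ` (`det = e^{t·tr log Q} = 1`).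
[cite: Balaban1985Averaging, (23) p.21] -/
theorem exp_smul_mlog_mem_specialUnitaryGroup {Q : Matrix n n ℂ} (hQ : Q ∈ Matrix.specialUnitaryGroup n ℂ) (hs : ‖Q - 1‖ ≤ 1 / 3)
    (hπ : Fintype.card n * ‖Q - 1‖ < Real.pi) (t : ℝ) :
    exp (((t : ℂ)) • mlog Q) ∈ Matrix.specialUnitaryGroup n ℂ := by
  rw [Matrix.mem_specialUnitaryGroup_iff]
  refine ⟨exp_smul_mlog_mem_unitaryGroup (Matrix.mem_specialUnitaryGroup_iff.1 hQ).1 hs t, ?_⟩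
  rw [det_exp_eq_exp_trace, Matrix.trace_smul, trace_mlog_eq_zero hQ hs hπ, smul_zero, exp_zero]

/-! ## §2 The arc `G_t(a,b) = exp(t·log(ba*))·a` -/

section Arc

variable {a b : Matrix n n ℂ}

/-- `G₀(a, b) = a`. [folklore] -/
theorem arc_zero (a b : Matrix n n ℂ) : exp ((((0 : ℝ) : ℂ)) • mlog (b * star a)) * a = a := by
  rw [Complex.ofReal_zero, zero_smul, exp_zero, one_mul]

/-- `G₁(a, b) = b` for unitary `a` and `‖ba* − 1‖ < 1` (`exp ∘ log = id`). [cite: Balaban1985Averaging, (21) p.21] -/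
theorem arc_one (ha : a ∈ Matrix.unitaryGroup n ℂ) (hab : ‖b * star a - 1‖ < 1) :
    exp ((((1 : ℝ) : ℂ)) • mlog (b * star a)) * a = b := by
  rw [Complex.ofReal_one, one_smul, exp_mlog hab, mul_assoc, Unitary.star_mul_self_of_mem ha, mul_one]

/-- For unitary `a`, `b`: `ba*` is unitary. [folklore] -/
theorem mul_star_mem (ha : a ∈ Matrix.unitaryGroup n ℂ) (hb : b ∈ Matrix.unitaryGroup n ℂ) : b * star a ∈ Matrix.unitaryGroup n ℂ :=
  Submonoid.mul_mem _ hb (Unitary.star_mem ha)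

/-- `a* ∈ SU(N)` for `a ∈ SU(N)`. [folklore] -/
theorem star_mem_SU (ha : a ∈ Matrix.specialUnitaryGroup n ℂ) : star a ∈ Matrix.specialUnitaryGroup n ℂ :=
  (star (⟨a, ha⟩ : Matrix.specialUnitaryGroup n ℂ)).2

/-- For special unitary `a`, `b`: `ba*` is special unitary. [folklore] -/
theorem mul_star_mem_SU (ha : a ∈ Matrix.specialUnitaryGroup n ℂ) (hb : b ∈ Matrix.specialUnitaryGroup n ℂ) :
    b * star a ∈ Matrix.specialUnitaryGroup n ℂ :=
  Submonoid.mul_mem _ hb (star_mem_SU ha)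

/-- **THE ARC STAYS IN `U(N)`**: `a, b ∈ U(N)`, `‖ba* − 1‖ ≤ 1/3` ⟹ `G_t(a,b) ∈ U(N)` for every real `t`. [cite: Balaban1985Averaging, (23) p.21] -/
theorem arc_mem_unitaryGroup (ha : a ∈ Matrix.unitaryGroup n ℂ) (hb : b ∈ Matrix.unitaryGroup n ℂ) (hab : ‖b * star a - 1‖ ≤ 1 / 3) (t : ℝ) :
    exp (((t : ℂ)) • mlog (b * star a)) * a ∈ Matrix.unitaryGroup n ℂ :=
  Submonoid.mul_mem _ (exp_smul_mlog_mem_unitaryGroup (mul_star_mem ha hb) hab t) ha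

/-- **THE ARC STAYS IN `SU(N)`**: `a, b ∈ SU(N)`, `‖ba* − 1‖ ≤ 1/3`, `N‖ba* − 1‖ < π` ⟹ `G_t(a,b) ∈ SU(N)`. [cite: Balaban1985Averaging, (23) p.21] -/
theorem arc_mem_specialUnitaryGroup (ha : a ∈ Matrix.specialUnitaryGroup n ℂ) (hb : b ∈ Matrix.specialUnitaryGroup n ℂ)
    (hab : ‖b * star a - 1‖ ≤ 1 / 3) (hπ : Fintype.card n * ‖b * star a - 1‖ < Real.pi) (t : ℝ) :
    exp (((t : ℂ)) • mlog (b * star a)) * a ∈ Matrix.specialUnitaryGroup n ℂ :=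
  Submonoid.mul_mem _ (exp_smul_mlog_mem_specialUnitaryGroup (mul_star_mem_SU ha hb) hab hπ t) ha

/-- **EQUIVARIANCE**: for unitary `u`, `w` and any `a`, `b`: `G_t(u a w, u b w) = u·G_t(a, b)·w` (`log` and `exp` commute with unitary conjugation,
[Balaban1985Averaging] p. 24 «their logarithms are unitarily equivalent with the same unitary operator»). [cite: Balaban1985Averaging, Sect. B p.24] -/
theorem arc_conj {u w : Matrix n n ℂ} (hu : u ∈ Matrix.unitaryGroup n ℂ) (hw : w ∈ Matrix.unitaryGroup n ℂ) (a b : Matrix n n ℂ) (t : ℝ) :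
    exp (((t : ℂ)) • mlog ((u * b * w) * star (u * a * w))) * (u * a * w) =
      u * (exp (((t : ℂ)) • mlog (b * star a)) * a) * w := by
  have hQ : (u * b * w) * star (u * a * w) = u * (b * star a) * star u := by
    simp only [star_mul, mul_assoc]
    rw [← mul_assoc w (star w), Unitary.mul_star_self_of_mem hw, one_mul]
  rw [hQ, mlog_conj (Unitary.mul_star_self_of_mem hu) (Unitary.star_mul_self_of_mem hu), ← smul_mul_assoc, ← mul_smul_comm,
    Literature.MathematicalPhysics.QuantumLattice.exp_conj_eq_of_mul_eq_one (Unitary.mul_star_self_of_mem hu) (Unitary.star_mul_self_of_mem hu)]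
  simp only [mul_assoc]
  rw [← mul_assoc (star u) u, Unitary.star_mul_self_of_mem hu, one_mul]

/-- `G_t(a,b)·G_s(a,b)* = exp((t − s)·log(ba*))` for unitary `a`, `b` with `‖ba* − 1‖ ≤ 1/3`. [folklore] -/
theorem arc_mul_star_arc (ha : a ∈ Matrix.unitaryGroup n ℂ) (hb : b ∈ Matrix.unitaryGroup n ℂ) (hab : ‖b * star a - 1‖ ≤ 1 / 3) (t s : ℝ) :
    (exp (((t : ℂ)) • mlog (b * star a)) * a) * star (exp (((s : ℂ)) • mlog (b * star a)) * a) =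
      exp ((((t - s : ℝ)) : ℂ) • mlog (b * star a)) := by
  letI : NormedAlgebra ℚ (Matrix n n ℂ) := NormedAlgebra.restrictScalars ℚ ℂ _
  set X : Matrix n n ℂ := mlog (b * star a) with hX
  rw [star_mul, star_exp, star_smul_mlog (mul_star_mem ha hb) hab s, mul_assoc, ← mul_assoc a, Unitary.mul_star_self_of_mem ha, one_mul,
    ← exp_add_of_commute, Complex.ofReal_sub, sub_smul, sub_eq_add_neg]
  exact ((Commute.refl X).smul_left _).smul_right _ |>.neg_right

/-- `‖exp Y − 1‖ ≤ 3‖Y‖` for `‖Y‖ ≤ 1` (`e^r − 1 ≤ r·e^r ≤ 3r`). [folklore] -/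
theorem norm_exp_sub_one_le_three_mul (Y : Matrix n n ℂ) (hY : ‖Y‖ ≤ 1) : ‖exp Y - 1‖ ≤ 3 * ‖Y‖ := by
  letI : NormedAlgebra ℝ (Matrix n n ℂ) := NormedAlgebra.restrictScalars ℝ ℂ _
  have h1 := Literature.Analysis.Calculus.norm_exp_sub_one_le Y
  have h0 : 0 ≤ ‖Y‖ := norm_nonneg _
  -- `e^r − 1 ≤ r e^r` and `e^r ≤ e ≤ 3`
  have h2 : Real.exp ‖Y‖ - 1 ≤ ‖Y‖ * Real.exp ‖Y‖ := by
    have := Real.add_one_le_exp (-‖Y‖)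
    have hpos := Real.exp_pos ‖Y‖
    have hmul : Real.exp (-‖Y‖) * Real.exp ‖Y‖ = 1 := by rw [← Real.exp_add, neg_add_cancel, Real.exp_zero]
    nlinarith
  have h3 : Real.exp ‖Y‖ ≤ 3 := (Real.exp_le_exp.2 hY).trans (by have := Real.exp_one_lt_d9; linarith)
  nlinarith

/-- `‖log(ba*)‖ ≤ 2‖ba* − 1‖` (B7 (26)). [cite: Balaban1985Averaging, (26) p.22] -/
theorem norm_mlog_mul_star_le (hab : ‖b * star a - 1‖ ≤ 1 / 3) : ‖mlog (b * star a)‖ ≤ 2 * ‖b * star a - 1‖ :=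
  norm_mlog_le_two_mul (hab.trans (by norm_num))

/-- **LIPSCHITZ IN THE PARAMETER**: `‖G_t·G_s* − 1‖ ≤ 3|t − s|·2‖ba* − 1‖` for `|t − s| ≤ 1` (unitary `a`, `b`, `‖ba* − 1‖ ≤ 1/3`).
[cite: Balaban1985Averaging, (24)-(27) pp.21-22] -/
theorem norm_arc_mul_star_arc_sub_one_le (ha : a ∈ Matrix.unitaryGroup n ℂ) (hb : b ∈ Matrix.unitaryGroup n ℂ) (hab : ‖b * star a - 1‖ ≤ 1 / 3)
    {t s : ℝ} (hts : |t - s| ≤ 1) :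
    ‖(exp (((t : ℂ)) • mlog (b * star a)) * a) * star (exp (((s : ℂ)) • mlog (b * star a)) * a) - 1‖ ≤
      6 * |t - s| * ‖b * star a - 1‖ := by
  rw [arc_mul_star_arc ha hb hab]
  have hX := norm_mlog_mul_star_le hab
  have hY : ‖((((t - s : ℝ)) : ℂ)) • mlog (b * star a)‖ = |t - s| * ‖mlog (b * star a)‖ := by
    rw [norm_smul, Complex.norm_real, Real.norm_eq_abs]
  have hY1 : ‖((((t - s : ℝ)) : ℂ)) • mlog (b * star a)‖ ≤ 1 := by
    rw [hY]
    have h23 : ‖mlog (b * star a)‖ ≤ 2 / 3 := by linarith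
    have := mul_le_mul hts h23 (norm_nonneg _) zero_le_one
    linarith
  refine (norm_exp_sub_one_le_three_mul _ hY1).trans ?_
  rw [hY]
  nlinarith [abs_nonneg (t - s), norm_nonneg (b * star a - 1)]

/-- **THE ARC STAYS NEAR ITS ENDPOINT**: `‖G_t(a,b)·a* − 1‖ ≤ 6|t|·‖ba* − 1‖` for `|t| ≤ 1`. [cite: Balaban1985Averaging, (24)-(27) pp.21-22] -/
theorem norm_arc_mul_star_sub_one_le (ha : a ∈ Matrix.unitaryGroup n ℂ) (hb : b ∈ Matrix.unitaryGroup n ℂ) (hab : ‖b * star a - 1‖ ≤ 1 / 3)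
    {t : ℝ} (ht : |t| ≤ 1) :
    ‖(exp (((t : ℂ)) • mlog (b * star a)) * a) * star a - 1‖ ≤ 6 * |t| * ‖b * star a - 1‖ := by
  have h := norm_arc_mul_star_arc_sub_one_le ha hb hab (t := t) (s := 0) (by rwa [sub_zero])
  rwa [arc_zero, sub_zero] at h

end Arc

/-! ## §3 Lipschitz dependence on the endpoints under left unitary perturbations -/

section Perturb

/-- `‖exp x − exp y‖ ≤ ‖x − y‖·e^{max ‖x‖ ‖y‖}` in `M_N(ℂ)` (the tree's `RungeUnits.norm_exp_sub_exp_le`). [folklore] -/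
theorem norm_exp_sub_exp_le' [Nonempty n] (x y : Matrix n n ℂ) : ‖exp x - exp y‖ ≤ ‖x - y‖ * Real.exp (max ‖x‖ ‖y‖) :=
  Literature.Analysis.Complex.norm_exp_sub_exp_le x y

/-- **LIPSCHITZ IN THE ENDPOINTS**: unitary `a, b, p, q` with `‖ba* − 1‖ ≤ 1/6`, `‖p − 1‖ ≤ 1/16`, `‖q − 1‖ ≤ 1/16`, `t ∈ [0, 1]` ⟹
`‖G_t(pa, qb)·G_t(a, b)* − 1‖ ≤ 8·(‖p − 1‖ + ‖q − 1‖)`.  (`(qb)(pa)* = q(ba*)p*` is within `(7/6)(‖p−1‖+‖q−1‖)` of `ba*`; `log` is `3/2`-Lipschitz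
on `‖· − 1‖ ≤ 1/3` and `exp` is `e^{2/3}`-Lipschitz on `‖·‖ ≤ 2/3`.) [cite: Balaban1985Averaging, (21)-(27) pp.21-22] -/
theorem norm_arc_perturb_le [Nonempty n] {a b p q : Matrix n n ℂ} (ha : a ∈ Matrix.unitaryGroup n ℂ) (hb : b ∈ Matrix.unitaryGroup n ℂ)
    (hp : p ∈ Matrix.unitaryGroup n ℂ) (hq : q ∈ Matrix.unitaryGroup n ℂ)
    (hab : ‖b * star a - 1‖ ≤ 1 / 6) (hp1 : ‖p - 1‖ ≤ 1 / 16) (hq1 : ‖q - 1‖ ≤ 1 / 16) {t : ℝ} (ht0 : 0 ≤ t) (ht1 : t ≤ 1) :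
    ‖(exp (((t : ℂ)) • mlog ((q * b) * star (p * a))) * (p * a)) * star (exp (((t : ℂ)) • mlog (b * star a)) * a) - 1‖ ≤
      8 * (‖p - 1‖ + ‖q - 1‖) := by
  letI : NormedAlgebra ℚ (Matrix n n ℂ) := NormedAlgebra.restrictScalars ℚ ℂ _
  set Q : Matrix n n ℂ := b * star a with hQdef
  set Q' : Matrix n n ℂ := (q * b) * star (p * a) with hQ'def
  have hQ'eq : Q' = q * Q * star p := by simp only [hQ'def, hQdef, star_mul, mul_assoc]
  -- `‖Q' − Q‖ ≤ (7/6)(‖p−1‖ + ‖q−1‖)`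
  have hQu : Q ∈ Matrix.unitaryGroup n ℂ := mul_star_mem ha hb
  have hdiff : ‖Q' - Q‖ ≤ ‖p - 1‖ + ‖q - 1‖ := by
    have hsplit : Q' - Q = (q - 1) * Q * star p + Q * (star p - 1) := by
      rw [hQ'eq]; noncomm_ring
    rw [hsplit]
    calc ‖(q - 1) * Q * star p + Q * (star p - 1)‖ ≤ ‖(q - 1) * Q * star p‖ + ‖Q * (star p - 1)‖ := norm_add_le _ _
      _ = ‖p - 1‖ + ‖q - 1‖ := by
          rw [CStarRing.norm_mul_mem_unitary _ (Unitary.star_mem hp), CStarRing.norm_mul_mem_unitary _ hQu,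
            CStarRing.norm_mem_unitary_mul _ hQu, ExpMeanLog.norm_star_sub_one]; ring
  have hQ1 : ‖Q - 1‖ ≤ 1 / 3 := hab.trans (by norm_num)
  have hQ'1 : ‖Q' - 1‖ ≤ 1 / 3 := by
    have : ‖Q' - 1‖ ≤ ‖Q' - Q‖ + ‖Q - 1‖ := by
      have := norm_add_le (Q' - Q) (Q - 1); rwa [sub_add_sub_cancel] at this
    linarith
  -- the exponents
  set X : Matrix n n ℂ := mlog Q with hXdef
  set X' : Matrix n n ℂ := mlog Q' with hX'def
  have hXX' : ‖X' - X‖ ≤ (3 / 2) * (‖p - 1‖ + ‖q - 1‖) := by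
    have h := norm_mlog_sub_mlog_le (ρ := 1 / 3) (by norm_num) hQ'1 hQ1
    have h32 : (1 : ℝ) + 1 / 3 / (1 - 1 / 3) = 3 / 2 := by norm_num
    rw [h32] at h
    exact h.trans (by nlinarith)
  have hXn : ‖X‖ ≤ 2 / 3 := (norm_mlog_le_two_mul (hQ1.trans (by norm_num))).trans (by linarith)
  have hX'n : ‖X'‖ ≤ 2 / 3 := (norm_mlog_le_two_mul (hQ'1.trans (by norm_num))).trans (by linarith)
  have htX : ‖((t : ℂ)) • X‖ ≤ 2 / 3 := by
    rw [norm_smul, Complex.norm_real, Real.norm_eq_abs, abs_of_nonneg ht0]; nlinarith [norm_nonneg X]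
  have htX' : ‖((t : ℂ)) • X'‖ ≤ 2 / 3 := by
    rw [norm_smul, Complex.norm_real, Real.norm_eq_abs, abs_of_nonneg ht0]; nlinarith [norm_nonneg X']
  have hexpdiff : ‖exp (((t : ℂ)) • X') - exp (((t : ℂ)) • X)‖ ≤ 3 * (‖p - 1‖ + ‖q - 1‖) := by
    refine (norm_exp_sub_exp_le' _ _).trans ?_
    have hm : Real.exp (max ‖((t : ℂ)) • X'‖ ‖((t : ℂ)) • X‖) ≤ 2 :=
      (Real.exp_le_exp.2 (max_le htX' htX)).trans
        ((Real.le_log_iff_exp_le two_pos).1 (by have := Real.log_two_gt_d9; linarith))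
    have hd : ‖((t : ℂ)) • X' - ((t : ℂ)) • X‖ ≤ (3 / 2) * (‖p - 1‖ + ‖q - 1‖) := by
      rw [← smul_sub, norm_smul, Complex.norm_real, Real.norm_eq_abs, abs_of_nonneg ht0]
      calc t * ‖X' - X‖ ≤ 1 * ‖X' - X‖ := mul_le_mul_of_nonneg_right ht1 (norm_nonneg _)
        _ ≤ (3 / 2) * (‖p - 1‖ + ‖q - 1‖) := by rw [one_mul]; exact hXX'
    calc ‖((t : ℂ)) • X' - ((t : ℂ)) • X‖ * Real.exp (max ‖((t : ℂ)) • X'‖ ‖((t : ℂ)) • X‖)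
        ≤ ((3 / 2) * (‖p - 1‖ + ‖q - 1‖)) * 2 := mul_le_mul hd hm (Real.exp_pos _).le (by positivity)
      _ = 3 * (‖p - 1‖ + ‖q - 1‖) := by ring
  -- unitarity of the exponentials
  have hE : exp (((t : ℂ)) • X) ∈ Matrix.unitaryGroup n ℂ := exp_smul_mlog_mem_unitaryGroup (mul_star_mem ha hb) hQ1 t
  have hE' : exp (((t : ℂ)) • X') ∈ Matrix.unitaryGroup n ℂ := by
    have hQ'u : Q' ∈ Matrix.unitaryGroup n ℂ := by
      rw [hQ'eq]; exact Submonoid.mul_mem _ (Submonoid.mul_mem _ hq (mul_star_mem ha hb)) (Unitary.star_mem hp)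
    exact exp_smul_mlog_mem_unitaryGroup hQ'u hQ'1 t
  -- the expression equals `exp(tX')·p·exp(tX)*`
  have hrw : (exp (((t : ℂ)) • X') * (p * a)) * star (exp (((t : ℂ)) • X) * a) = exp (((t : ℂ)) • X') * p * star (exp (((t : ℂ)) • X)) := by
    rw [star_mul, mul_assoc, mul_assoc, ← mul_assoc a, Unitary.mul_star_self_of_mem ha, one_mul, ← mul_assoc]
  rw [hrw]
  have hEE : exp (((t : ℂ)) • X) * star (exp (((t : ℂ)) • X)) = 1 := Unitary.mul_star_self_of_mem hE
  have hsplit : exp (((t : ℂ)) • X') * p * star (exp (((t : ℂ)) • X)) - 1 =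
      (exp (((t : ℂ)) • X') - exp (((t : ℂ)) • X)) * p * star (exp (((t : ℂ)) • X)) +
        exp (((t : ℂ)) • X) * (p - 1) * star (exp (((t : ℂ)) • X)) := by
    have h0 : exp (((t : ℂ)) • X') * p * star (exp (((t : ℂ)) • X)) - exp (((t : ℂ)) • X) * star (exp (((t : ℂ)) • X)) =
        (exp (((t : ℂ)) • X') - exp (((t : ℂ)) • X)) * p * star (exp (((t : ℂ)) • X)) +
          exp (((t : ℂ)) • X) * (p - 1) * star (exp (((t : ℂ)) • X)) := by
      noncomm_ring
    rwa [hEE] at h0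
  rw [hsplit]
  calc ‖(exp (((t : ℂ)) • X') - exp (((t : ℂ)) • X)) * p * star (exp (((t : ℂ)) • X)) +
        exp (((t : ℂ)) • X) * (p - 1) * star (exp (((t : ℂ)) • X))‖
      ≤ ‖(exp (((t : ℂ)) • X') - exp (((t : ℂ)) • X)) * p * star (exp (((t : ℂ)) • X))‖ +
        ‖exp (((t : ℂ)) • X) * (p - 1) * star (exp (((t : ℂ)) • X))‖ := norm_add_le _ _
    _ = ‖exp (((t : ℂ)) • X') - exp (((t : ℂ)) • X)‖ + ‖p - 1‖ := by
        rw [CStarRing.norm_mul_mem_unitary _ (Unitary.star_mem hE), CStarRing.norm_mul_mem_unitary _ hp,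
          CStarRing.norm_mul_mem_unitary _ (Unitary.star_mem hE), CStarRing.norm_mem_unitary_mul _ hE]
    _ ≤ 3 * (‖p - 1‖ + ‖q - 1‖) + ‖p - 1‖ := by linarith
    _ ≤ 8 * (‖p - 1‖ + ‖q - 1‖) := by nlinarith [norm_nonneg (p - 1), norm_nonneg (q - 1)]

end Perturb

end Summit.QuantumFields.YangMills.Theorems.Prop7GeodesicInterp

end
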